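import Summits.Ventures.PercRepro.C026ProbeTransfer

/-!
# The `κ`-induction at the probe: mine-3's program as a tree theorem, conditional on the `c`–non-mark
step (p6, gen 15; MINE3-MARKEDGE §8 (a))

Write `(CE)` (`CEdgeStep γ κ'`) for: SA with the constant `κ'` for the `γ`-slack holds at every
fractional non-loop edge joining the probe to a non-mark, for every weight vector and every probe.  Then
for `0 < κ ≤ ¾` the `κ`-slack `P(B ∧ Aᶜ) − κ P(B) P(Aᶜ)` is nonnegative for every weight vector
(`slackGamma_nonneg_of_cEdgeStep`): strong induction on the fractional edges; at an instance either the
sure cluster of the probe contains a mark (then the probe reaches a mark surely and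
`s_κ = (1 − κ) P(Aᶜ) ≥ 0`, `slackGamma_nonneg_probe_mark`), or some fractional edge touches the sure
cluster (`saGamma_of_touching_edge`: a mark–`w` edge by `SAGamma26_of_markC`, an edge inside the cluster
by `SAGamma26_of_sureConn_endpoints`, a `w`–non-mark edge by `(CE)` — each transferred to the probe —
then `slackGamma_nonneg_of_saGamma` on the two minors), or no fractional edge touches it and the probe
reaches no mark at all (`slackGamma_eq_zero_of_isolated`).  The mark–`c` step being a theorem
(`C026MarkCKappa`), the whole of mine-3's program rests on `(CE)`; at `κ = ½` (constants `(½, 2)`) this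
is the cell's reduction of record, C-026 ⟸ SA at `c`-edges.
-/

namespace PercRepro

open Finset

namespace MultiGraph

variable {V E : Type*} (G : MultiGraph V E) [Fintype E] [DecidableEq E]

/-! ### The `c`–non-mark step as a hypothesis, and the induction -/

/-- **The `c`–non-mark step** `(CE)` with constants `(γ, κ')`: for every weight vector, every probe `w`
and every fractional non-loop edge joining `w` to a vertex that is not a mark, SA with the constant `κ'`
for the `γ`-slack holds.  A hypothesis (mine-3's `(CE_κ)` is `γ = κ`, `κ' = 1/κ`), never assumed silently. -/
def CEdgeStep (γ κ' : ℝ) (a b : V) : Prop :=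
  ∀ (p : E → ℝ), IsProb p → ∀ (w : V) (e : E), e ∈ fracEdges p → G.fst e ≠ G.snd e →
    ((G.fst e = w ∧ G.snd e ≠ a ∧ G.snd e ≠ b) ∨ (G.snd e = w ∧ G.fst e ≠ a ∧ G.fst e ≠ b)) →
    G.SAGamma26 γ κ' p e a b w

/-- With the probe AT a mark, the `γ`-slack is `(1 − γ) P(Aᶜ) ≥ 0`. -/
theorem slackGamma_nonneg_probe_mark {γ : ℝ} (hγ : γ ≤ 1) {p : E → ℝ} (hp : IsProb p) (a b : V) :
    0 ≤ G.slackGamma γ p a b a ∧ 0 ≤ G.slackGamma γ p a b b := by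
  have hB : ∀ c : V, G.connEvent c a ∪ G.connEvent c b = Set.univ → 0 ≤ G.slackGamma γ p a b c := by
    intro c hc
    rw [slackGamma_eq_prob, hc, Set.univ_inter, prob_univ]
    have := prob_nonneg hp (G.sepEvent a b)
    nlinarith
  constructor
  · refine hB a ?_
    ext ω
    simp only [Set.mem_union, mem_connEvent, Set.mem_univ, iff_true]
    exact Or.inl (Conn.refl G ω a)
  · refine hB b ?_
    ext ω
    simp only [Set.mem_union, mem_connEvent, Set.mem_univ, iff_true]
    exact Or.inr (Conn.refl G ω b)

/-- If no fractional edge touches the sure cluster of `c` and the cluster holds no mark, `c` reaches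
no mark at all: the `γ`-slack is `0`. -/
theorem slackGamma_eq_zero_of_isolated {γ : ℝ} {p : E → ℝ} (hp : IsProb p) {a b c : V}
    (hmark : ¬ (G.SureConn p c a ∨ G.SureConn p c b))
    (hfrac : ¬ ∃ e ∈ fracEdges p, G.SureConn p c (G.fst e) ∨ G.SureConn p c (G.snd e)) :
    G.slackGamma γ p a b c = 0 := by
  have hclosed : ∀ ω : Config E, 0 < weight p ω → ∀ e, ω e = true →
      (G.SureConn p c (G.fst e) ↔ G.SureConn p c (G.snd e)) := by
    intro ω hω e he
    by_cases h1 : p e = 1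
    · have hadj : G.Conn (sureConfig p) (G.fst e) (G.snd e) :=
        Conn.of_openAdj (G.openAdj_of_open e (by simp [sureConfig, h1]))
      exact ⟨fun h => h.trans hadj, fun h => h.trans hadj.symm⟩
    · by_cases h0 : p e = 0
      · exact absurd he (by simp [eq_false_of_weight_pos hω h0])
      · have hmem : e ∈ fracEdges p := by
          simp only [fracEdges, Finset.mem_filter, Finset.mem_univ, true_and]
          exact ⟨h0, h1⟩
        constructor
        · intro h
          exact absurd ⟨e, hmem, Or.inl h⟩ hfrac
        · intro h
          exact absurd ⟨e, hmem, Or.inr h⟩ hfrac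
  have hno : ∀ m : V, ¬ G.SureConn p c m → prob p (G.connEvent c m) = 0 := by
    intro m hm
    refine prob_eq_zero_of_subset_weight_zero hp fun ω hω hpos => hm ?_
    exact mem_of_conn_of_closed_boundary (X := {v | G.SureConn p c v})
      (fun e he => hclosed ω hpos e he) (Conn.refl G _ c) hω
  have ha : prob p (G.connEvent c a) = 0 := hno a fun h => hmark (Or.inl h)
  have hb : prob p (G.connEvent c b) = 0 := hno b fun h => hmark (Or.inr h)
  have hB : prob p (G.connEvent c a ∪ G.connEvent c b) = 0 := by
    have := prob_union_le hp (G.connEvent c a) (G.connEvent c b)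
    have := prob_nonneg hp (G.connEvent c a ∪ G.connEvent c b)
    linarith
  have hBA : prob p ((G.connEvent c a ∪ G.connEvent c b) ∩ G.sepEvent a b) = 0 := by
    have := prob_inter_le_left hp (G.connEvent c a ∪ G.connEvent c b) (G.sepEvent a b)
    have := prob_nonneg hp ((G.connEvent c a ∪ G.connEvent c b) ∩ G.sepEvent a b)
    linarith
  rw [slackGamma_eq_prob, hB, hBA]
  ring

omit [Fintype E] in
/-- `SureConn` is preserved when a fractional edge is set to `0`. -/
theorem sureConn_update_zero {p : E → ℝ} {e : E} (he : p e ≠ 1) {u v : V} (h : G.SureConn p u v) :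
    G.SureConn (Function.update p e 0) u v := by
  unfold SureConn
  rw [sureConfig_update_zero he]
  exact h

/-- **SA at a fractional edge touching the sure cluster** (the step of the induction): given `(CE)`
with constants `(κ, 1/κ)`, `0 < κ ≤ ¾`, a sure cluster of `c` holding no mark, and the deletion minor's
`κ`-slack `≥ 0`, SA with the constant `1/κ` for `s_κ` holds at every fractional edge touching the sure
cluster — at a mark by `SAGamma26_of_markC`, inside the cluster by `SAGamma26_of_sureConn_endpoints`,
at a non-mark by `(CE)`; each transferred from the touching vertex to the probe `c`. -/
theorem saGamma_of_touching_edge {κ : ℝ} (hκ0 : 0 < κ) (hκ : κ ≤ 3 / 4) {a b : V}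
    (hCE : G.CEdgeStep κ (1 / κ) a b) {p : E → ℝ} (hp : IsProb p) {c : V}
    (hmark : ¬ (G.SureConn p c a ∨ G.SureConn p c b)) {e : E} (he : e ∈ fracEdges p)
    (htouch : G.SureConn p c (G.fst e) ∨ G.SureConn p c (G.snd e))
    (h0 : 0 ≤ G.slackGamma κ (Function.update p e 0) a b c) :
    G.SAGamma26 κ (1 / κ) p e a b c := by
  have hfrac : p e ≠ 0 ∧ p e ≠ 1 := by
    simpa [fracEdges] using he
  have hκ'0 : 0 ≤ 1 / κ := by positivity
  -- reduce to the touching endpoint `w` with the other endpoint `w'`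
  have key : ∀ w w' : V, G.SureConn p c w →
      ((G.fst e = w ∧ G.snd e = w') ∨ (G.fst e = w' ∧ G.snd e = w)) →
      G.SAGamma26 κ (1 / κ) p e a b c := by
    intro w w' hcw hend
    have hw_a : w ≠ a := fun h => hmark (Or.inl (h ▸ hcw))
    have hw_b : w ≠ b := fun h => hmark (Or.inr (h ▸ hcw))
    -- transfer the deletion minor's slack to the probe `w`
    have h0w : 0 ≤ G.slackGamma κ (Function.update p e 0) a b w := by
      rw [← G.slackGamma_eq_of_sureConn κ _ (G.sureConn_update_zero hfrac.2 hcw) a b]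
      exact h0
    rw [G.SAGamma26_iff_of_sureConn κ (1 / κ) hfrac.2 hcw a b]
    by_cases hw' : G.SureConn p c w'
    · -- both endpoints in the sure cluster
      have hxy : G.SureConn p (G.fst e) (G.snd e) := by
        rcases hend with ⟨h1, h2⟩ | ⟨h1, h2⟩
        · rw [h1, h2]
          exact hcw.symm.trans hw'
        · rw [h1, h2]
          exact hw'.symm.trans hcw
      rw [← G.SAGamma26_iff_of_sureConn κ (1 / κ) hfrac.2 hcw a b]
      exact G.SAGamma26_of_sureConn_endpoints κ hκ'0 hp hfrac.2 hxy h0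
    · by_cases hw'a : w' = a
      · subst hw'a
        refine G.SAGamma26_of_markC hκ0 hκ hp ?_ h0w
        rcases hend with ⟨h1, h2⟩ | ⟨h1, h2⟩
        · exact Or.inl (Or.inr ⟨h1, h2⟩)
        · exact Or.inl (Or.inl ⟨h1, h2⟩)
      · by_cases hw'b : w' = b
        · subst hw'b
          refine G.SAGamma26_of_markC hκ0 hκ hp ?_ h0w
          rcases hend with ⟨h1, h2⟩ | ⟨h1, h2⟩
          · exact Or.inr (Or.inr ⟨h1, h2⟩)
          · exact Or.inr (Or.inl ⟨h1, h2⟩)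
        · -- the `c`–non-mark step for the probe `w`
          have hne : G.fst e ≠ G.snd e := by
            intro h
            apply hw'
            rcases hend with ⟨h1, h2⟩ | ⟨h1, h2⟩
            · rw [← h2, ← h, h1]
              exact hcw
            · rw [← h1, h, h2]
              exact hcw
          refine hCE p hp w e he hne ?_
          rcases hend with ⟨h1, h2⟩ | ⟨h1, h2⟩
          · exact Or.inl ⟨h1, h2 ▸ hw'a, h2 ▸ hw'b⟩
          · exact Or.inr ⟨h2, h1 ▸ hw'a, h1 ▸ hw'b⟩
  rcases htouch with h | h
  · exact key (G.fst e) (G.snd e) h (Or.inl ⟨rfl, rfl⟩)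
  · exact key (G.snd e) (G.fst e) h (Or.inr ⟨rfl, rfl⟩)

/-- **The `κ`-induction at the probe** (mine-3's program, MINE3-MARKEDGE §8 (a)): for `0 < κ ≤ ¾`, the
`c`–non-mark step `(CE)` with constants `(κ, 1/κ)` gives `s_κ ≥ 0` — i.e. `P(B ∧ Aᶜ) ≥ κ·P(B)·P(Aᶜ)` —
for every weight vector and every probe.  Strong induction on the fractional edges: the sure cluster of
the probe either holds a mark (`slackGamma_nonneg_probe_mark` after transfer), or is touched by a
fractional edge (`saGamma_of_touching_edge`, then `slackGamma_nonneg_of_saGamma` on the two minors), or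
is isolated (`slackGamma_eq_zero_of_isolated`). -/
theorem slackGamma_nonneg_of_cEdgeStep {κ : ℝ} (hκ0 : 0 < κ) (hκ : κ ≤ 3 / 4) (a b : V)
    (hCE : G.CEdgeStep κ (1 / κ) a b) :
    ∀ p : E → ℝ, IsProb p → ∀ c : V, 0 ≤ G.slackGamma κ p a b c := by
  have hκ1 : κ ≤ 1 := by linarith
  have hκ'0 : 0 ≤ 1 / κ := by positivity
  have hγκ : κ * (1 / κ) ≤ 1 := by
    rw [mul_one_div_cancel hκ0.ne']
  suffices H : ∀ n : ℕ, ∀ p : E → ℝ, IsProb p → (fracEdges p).card = n → ∀ c : V,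
      0 ≤ G.slackGamma κ p a b c by
    intro p hp c
    exact H _ p hp rfl c
  intro n
  refine Nat.strong_induction_on n ?_
  intro n ih p hp hn c
  by_cases hmark : G.SureConn p c a ∨ G.SureConn p c b
  · rcases hmark with h | h
    · rw [G.slackGamma_eq_of_sureConn κ p h a b]
      exact (G.slackGamma_nonneg_probe_mark hκ1 hp a b).1
    · rw [G.slackGamma_eq_of_sureConn κ p h a b]
      exact (G.slackGamma_nonneg_probe_mark hκ1 hp a b).2
  · by_cases hfrac : ∃ e ∈ fracEdges p, G.SureConn p c (G.fst e) ∨ G.SureConn p c (G.snd e)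
    · obtain ⟨e, he, htouch⟩ := hfrac
      have h0 : 0 ≤ G.slackGamma κ (Function.update p e 0) a b c :=
        ih _ (hn ▸ card_fracEdges_update_lt he (Or.inl rfl)) _
          (hp.update e ⟨le_rfl, zero_le_one⟩) rfl c
      have h1 : 0 ≤ G.slackGamma κ (Function.update p e 1) a b c :=
        ih _ (hn ▸ card_fracEdges_update_lt he (Or.inr rfl)) _
          (hp.update e ⟨zero_le_one, le_rfl⟩) rfl c
      exact G.slackGamma_nonneg_of_saGamma hκ0.le hκ'0 hγκ hp
        (G.saGamma_of_touching_edge hκ0 hκ hCE hp hmark he htouch h0) h0 h1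
    · rw [G.slackGamma_eq_zero_of_isolated hp hmark hfrac]

/-! ### An unconditional class: every fractional edge at a mark -/

/-- A fractional edge of a minor is a fractional edge of the instance. -/
theorem fracEdges_update_subset' {p : E → ℝ} (e : E) {x : ℝ} (hx : x = 0 ∨ x = 1) :
    fracEdges (Function.update p e x) ⊆ fracEdges p :=
  fun _ he' => Finset.mem_of_mem_erase (fracEdges_update_subset p e hx he')

/-- **`ρ ≥ ¾` when every fractional edge is incident to a mark** (unconditional): if each edge whose
weight is neither `0` nor `1` has `a` or `b` as an endpoint, then `P(B ∧ Aᶜ) ≥ κ·P(B)·P(Aᶜ)` for every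
`κ ≤ ¾` and every probe — the `κ`-induction never meets a `c`–non-mark edge. -/
theorem slackGamma_nonneg_of_fracEdges_at_marks {κ : ℝ} (hκ0 : 0 < κ) (hκ : κ ≤ 3 / 4) (a b : V) :
    ∀ p : E → ℝ, IsProb p →
      (∀ e ∈ fracEdges p, G.fst e = a ∨ G.fst e = b ∨ G.snd e = a ∨ G.snd e = b) →
      ∀ c : V, 0 ≤ G.slackGamma κ p a b c := by
  have hκ1 : κ ≤ 1 := by linarith
  have hκ'0 : 0 ≤ 1 / κ := by positivity
  have hγκ : κ * (1 / κ) ≤ 1 := by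
    rw [mul_one_div_cancel hκ0.ne']
  suffices H : ∀ n : ℕ, ∀ p : E → ℝ, IsProb p → (fracEdges p).card = n →
      (∀ e ∈ fracEdges p, G.fst e = a ∨ G.fst e = b ∨ G.snd e = a ∨ G.snd e = b) →
      ∀ c : V, 0 ≤ G.slackGamma κ p a b c by
    intro p hp hm c
    exact H _ p hp rfl hm c
  intro n
  refine Nat.strong_induction_on n ?_
  intro n ih p hp hn hm c
  by_cases hmark : G.SureConn p c a ∨ G.SureConn p c b
  · rcases hmark with h | h
    · rw [G.slackGamma_eq_of_sureConn κ p h a b]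
      exact (G.slackGamma_nonneg_probe_mark hκ1 hp a b).1
    · rw [G.slackGamma_eq_of_sureConn κ p h a b]
      exact (G.slackGamma_nonneg_probe_mark hκ1 hp a b).2
  · by_cases hfrac : ∃ e ∈ fracEdges p, G.SureConn p c (G.fst e) ∨ G.SureConn p c (G.snd e)
    · obtain ⟨e, he, htouch⟩ := hfrac
      have h0 : 0 ≤ G.slackGamma κ (Function.update p e 0) a b c :=
        ih _ (hn ▸ card_fracEdges_update_lt he (Or.inl rfl)) _
          (hp.update e ⟨le_rfl, zero_le_one⟩) rfl
          (fun e' he' => hm e' (fracEdges_update_subset' e (Or.inl rfl) he')) c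
      have h1 : 0 ≤ G.slackGamma κ (Function.update p e 1) a b c :=
        ih _ (hn ▸ card_fracEdges_update_lt he (Or.inr rfl)) _
          (hp.update e ⟨zero_le_one, le_rfl⟩) rfl
          (fun e' he' => hm e' (fracEdges_update_subset' e (Or.inr rfl) he')) c
      -- the touching edge is a mark–`w` edge (the cluster holds no mark), or lies inside the cluster
      have hfr : p e ≠ 1 := by
        simpa [fracEdges] using (And.right (by simpa [fracEdges] using he : p e ≠ 0 ∧ p e ≠ 1))
      have hsa : G.SAGamma26 κ (1 / κ) p e a b c := by
        have key : ∀ w w' : V, G.SureConn p c w →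
            ((G.fst e = w ∧ G.snd e = w') ∨ (G.fst e = w' ∧ G.snd e = w)) →
            G.SAGamma26 κ (1 / κ) p e a b c := by
          intro w w' hcw hend
          have hw_a : w ≠ a := fun h => hmark (Or.inl (h ▸ hcw))
          have hw_b : w ≠ b := fun h => hmark (Or.inr (h ▸ hcw))
          have h0w : 0 ≤ G.slackGamma κ (Function.update p e 0) a b w := by
            rw [← G.slackGamma_eq_of_sureConn κ _ (G.sureConn_update_zero hfr hcw) a b]
            exact h0
          rw [G.SAGamma26_iff_of_sureConn κ (1 / κ) hfr hcw a b]
          have hw' : w' = a ∨ w' = b := by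
            rcases hm e he with h | h | h | h <;> rcases hend with ⟨h1, h2⟩ | ⟨h1, h2⟩
            · exact absurd (h1.symm.trans h) hw_a
            · exact Or.inl (h1.symm.trans h)
            · exact absurd (h1.symm.trans h) hw_b
            · exact Or.inr (h1.symm.trans h)
            · exact Or.inl (h2.symm.trans h)
            · exact absurd (h2.symm.trans h) hw_a
            · exact Or.inr (h2.symm.trans h)
            · exact absurd (h2.symm.trans h) hw_b
          rcases hw' with rfl | rfl
          · refine G.SAGamma26_of_markC hκ0 hκ hp ?_ h0w
            rcases hend with ⟨h1, h2⟩ | ⟨h1, h2⟩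
            · exact Or.inl (Or.inr ⟨h1, h2⟩)
            · exact Or.inl (Or.inl ⟨h1, h2⟩)
          · refine G.SAGamma26_of_markC hκ0 hκ hp ?_ h0w
            rcases hend with ⟨h1, h2⟩ | ⟨h1, h2⟩
            · exact Or.inr (Or.inr ⟨h1, h2⟩)
            · exact Or.inr (Or.inl ⟨h1, h2⟩)
        rcases htouch with h | h
        · exact key (G.fst e) (G.snd e) h (Or.inl ⟨rfl, rfl⟩)
        · exact key (G.snd e) (G.fst e) h (Or.inr ⟨rfl, rfl⟩)
      exact G.slackGamma_nonneg_of_saGamma hκ0.le hκ'0 hγκ hp hsa h0 h1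
    · rw [G.slackGamma_eq_zero_of_isolated hp hmark hfrac]

/-- **C-026 with the constant `4/3` when every fractional edge is incident to a mark**:
`2·P(B ∧ Aᶜ) ≥ (4/3)·P(B)·P(Aᶜ)`, hence `C026At`. -/
theorem C026At_of_fracEdges_at_marks {V E : Type} (G : MultiGraph V E) [Fintype E] [DecidableEq E]
    (a b c : V) (p : E → ℝ) (hp : IsProb p)
    (hm : ∀ e ∈ fracEdges p, G.fst e = a ∨ G.fst e = b ∨ G.snd e = a ∨ G.snd e = b) :
    G.C026At p a b c := by
  rw [G.C026At_iff_slack26_nonneg, G.slack26_eq_two_mul_slackGamma_half]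
  have h := G.slackGamma_nonneg_of_fracEdges_at_marks (κ := 3 / 4) (by norm_num) le_rfl a b p hp hm c
  have hB := prob_nonneg hp (G.connEvent c a ∪ G.connEvent c b)
  have hA := prob_nonneg hp (G.sepEvent a b)
  rw [slackGamma_eq_prob] at h ⊢
  nlinarith [mul_nonneg hB hA]

end MultiGraph

end PercRepro
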